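import Literature.Geometry.DiscreteGeometry.EnergyLinearProgrammingBound

/-!
# Certified LP lower bound for the inverse-square energy of 6 points on S³

Framing: lottery ticket; floor = certified bounds/negative ranges. Venture `PackingBounds` (cell
`pub-packcert`, seat `pub-packcert-energy`), energy-minimisation family, **certified (non-sharp)
row**.

**Theorem.** Every `6`-point configuration `C ⊂ S^3` of unit vectors of `ℝ^4` has `Σ_{x ≠ y ∈ C}
|x - y|^(-2) ≥ 12833/1000` (ordered pairs; `= 12.833000`). For comparison, an explicit rational
configuration (cell file results/upper_n4_N6_s2.json) has certified energy ≤ 13.000000000, so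
12.833 ≤ min ≤ 13.0000000 (relative gap 1.28e-02); the LP bound is not sharp here.

Proof: the linear programming bound for energy
(`Literature.Geometry.DiscreteGeometry.EnergyLP.energy_ge`, Yudin 1992 / Cohn–Kumar 2007 Prop.
4.1) applied to an exact certificate `h = Σ_k α_k C_k^(1)` supported on `k ∈ [0, 1, 2]` — the
support of the numerically optimal truncated LP solution — and determined by double contact with
`t ↦ (2-2t)^(-1)` at the rational nodes `-1/8` (rounded tangency points of the LP optimum). All
`α_k ≥ 0`, and the kernel checks the polynomial identity `1 - (2 - 2t) h(t) = W(t) q(t)` with `W =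
(t+1)·R²`, `R = Π (t - node)`, and `q ≥ 0` on `[-1, 1]` by an explicit Handelman (Bernstein) form
with nonnegative coefficients. The exact certified value is `6² α_0 - 6 h(1) = 12.833333333…` (a
rational with 2-digit numerator, in the cell's `certs/hs_n4_N6_s2.json`); the statement rounds it
down to `12833/1000`. The bound is NOT sharp and is within `2e-5` (relative) of the optimum of the
degree-`14` truncated LP; raising the degree can only improve it.

## References
* H. Cohn, A. Kumar, J. Amer. Math. Soc. 20 (2007) 99–148, Prop. 4.1. [`CohnKumar2006`]
* V. A. Yudin, Discrete Math. Appl. 3 (1993) 75–81. [`Yudin1993`]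
-/

namespace Summit.Ventures.PackingBounds.Energy

open Finset Literature.Analysis.SpecialFunctions Literature.Geometry.DiscreteGeometry

open scoped Classical in
/-- **Certified LP lower bound `Σ_{x ≠ y} |x - y|^(-2) ≥ 12833/1000` for `6` points on `S^3`**
(not sharp). For comparison, an explicit rational configuration (cell file
results/upper_n4_N6_s2.json) has certified energy ≤ 13.000000000, so 12.833 ≤ min ≤ 13.0000000
(relative gap 1.28e-02); the LP bound is not sharp here. Certificate: support `[0, 1, 2]`,
double-contact nodes `-1/8`, exact rational Gegenbauer coefficients, kernel-checked
factorisation `1 - (2-2t)h = W·q`. [cite: CohnKumar2006, Proposition 4.1] -/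
theorem riesz2_energy_dim4_card6_ge (C : Finset (EuclideanSpace ℝ (Fin 4)))
    (h1 : ∀ x ∈ C, ‖x‖ = 1) (hN : C.card = 6) :
    (12833 / 1000 : ℝ) ≤ ∑ x ∈ C, ∑ y ∈ C.erase x, (‖x - y‖ ^ 2)⁻¹ := by
  have hα : ∀ k : ℕ, (0 : ℝ) ≤ (fun k => match k with
        | 0 => 59 / 108 | 1 => 2 / 9 | 2 => 4 / 81 | _ => 0) k := by
    intro k
    dsimp only
    split <;> norm_num
  have hH : ∀ t : ℝ, -1 ≤ t → t < 1 →
      ∑ k ∈ range (2 + 1), (fun k => match k with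
        | 0 => 59 / 108 | 1 => 2 / 9 | 2 => 4 / 81 | _ => 0) k *
          gegenbauerSum (1 : ℝ) k t ≤
        (fun r : ℝ => r⁻¹) (2 - 2 * t) := by
    intro t ht1 ht2
    have hsum : ∑ k ∈ range (2 + 1), (fun k => match k with
        | 0 => 59 / 108 | 1 => 2 / 9 | 2 => 4 / 81 | _ => 0) k *
          gegenbauerSum (1 : ℝ) k t =
        161 / 324 + 4 / 9 * t + 16 / 81 * t ^ 2 := by
      simp [Finset.sum_range_succ, gegenbauerSum, gegenbauerCoeff, Finset.prod_range_succ,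
        Nat.factorial]
      ring
    rw [hsum]
    have hpos : (0 : ℝ) < 2 - 2 * t := by linarith
    have ht0 : (0 : ℝ) ≤ t + 1 := by linarith
    show _ ≤ (2 - 2 * t)⁻¹
    rw [inv_eq_one_div, le_div_iff₀ hpos]
    have hid : (161 / 324 + 4 / 9 * t + 16 / 81 * t ^ 2) * (2 - 2 * t) =
        1 - ((t + 1) * (1 / 8 + t) ^ 2) *
          (32 / 81) := by
      ring
    have hW : (0 : ℝ) ≤
          (t + 1) * (1 / 8 + t) ^ 2 :=
      (mul_nonneg ht0 (sq_nonneg _))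
    have hq : (0 : ℝ) ≤
          32 / 81 := by
      norm_num
    rw [hid]
    nlinarith [mul_nonneg hW hq]
  have key := EnergyLP.energy_ge (n := 4) (μ := 1) (by norm_num) (by norm_num) 2
    (fun k => match k with
        | 0 => 59 / 108 | 1 => 2 / 9 | 2 => 4 / 81 | _ => 0)
    hα (fun r : ℝ => r⁻¹) hH C h1
  rw [hN] at key
  refine le_trans ?_ key
  norm_num [Finset.sum_range_succ, gegenbauerSum, gegenbauerCoeff, Finset.prod_range_succ,
    Nat.factorial]

end Summit.Ventures.PackingBounds.Energy
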